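import Summits.Ventures.HSemireg.EdgeUnitClassDead
import Summits.Ventures.HSemireg.EdgeLeadingDigit

/-!
# The edge unit is CLASS-DEAD for EVERY integral class 2-form (pub-hsemireg, S4-PUSH corner 2)

Kernel leg of seat s4-search-2 gen 17 (cell `pub-hsemireg`), ROW U; composition of ROW J
(`EdgeUnitClassDead.edge_unit_classDead`, the (2,2,3,3,3,3) edge unit of the M2 cell, 83 classes) with ROW T
(`EdgeLeadingDigit.edge_leadingDigit_of_criterionL_two`).  `edge_unit_classDead_of_mem_span`: ROW J's theorem with
the hypotheses `hC` (leading digit on the slot pair), `hp` (odd Pfaffian), `hX` (first digit), `hB : B = C + 2X`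
REPLACED by `mB : B ∈ Submodule.span ℤ {ι p ι q}` — CRITERION L fails at `k = 2` or `k = 3` for EVERY integral class
2-form of the edge type; the leading-digit identification is discharged inside the kernel (if `k = 2` holds, ROW T
produces `C`, `p`, `X`; `X`'s alternating coefficient array from `DecomposableTwoForms.exists_coeff_of_mem_span`,
written out by `EdgeLeadingDigit.sum_pairs_twelve`, is ROW J's first digit).

Scope ∕ honest framing as in ROW J: CLASS-LEVEL, NECESSARY-condition bookkeeping (CRITERION L) at the special fibre
`E⁶`; CRITERION L as the registered necessary condition, the signature table (`σ₁ = 0`, `σ₀` odd, `σ₂ = 4t − σ₀`,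
`σ₃ = 4u` on these classes) and the census remain framework words; theorems only (count-neutral, no `def`); no object,
no `σ` computation, no Hodge statement; nothing here bears on HC ∕ HC_CM ∕ HC_AV.
-/

namespace Summit.Ventures.HSemireg.EdgeUnitEveryDigit

open ExteriorAlgebra DecomposableTwoForms EdgeLeadingDigit EdgeUnitClassDead

variable {M : Type*} [AddCommGroup M] [Module ℤ M]

set_option maxHeartbeats 2000000 in
/-- **THE (2,2,3,3,3,3) EDGE UNIT IS CLASS-DEAD FOR EVERY INTEGRAL CLASS 2-FORM.**  Setting of ROW J
(`EdgeUnitClassDead.edge_unit_classDead`), but with the class 2-form `B` ANY element of the `ℤ`-span of the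
2-vectors (no leading digit `C`, no Pfaffian hypothesis, no first digit `X`): CRITERION L fails at `k = 2` or at
`k = 3`, `¬(T₂ = 64·Z₂ ∧ T₃ = 1024·Z₃)` for every `Z₂ ∈ Λ` and every `Z₃`.  Proof: if `T₂ = 64Z₂` then
`EdgeLeadingDigit.edge_leadingDigit_of_criterionL_two` produces the leading digit `C` on the slot pair with odd
Pfaffian and `B = C + 2X`; `X`'s coefficient array (`DecomposableTwoForms.exists_coeff_of_mem_span`, written out by
`EdgeLeadingDigit.sum_pairs_twelve`) is the first digit; ROW J applies verbatim. -/
theorem edge_unit_classDead_of_mem_span (x : Module.Basis (Fin 12) ℤ M) (Λ : Subalgebra ℤ (ExteriorAlgebra ℤ M))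
    (h₀ h₁ l₁ l₂ l₃ l₄ h₂ h₃ h₄ h₅ σ₀ σ₁ σ₂ σ₃ s t u H H₂ S₁ S₂ S₃ D D₂ D₃ B B₂ B₃ T₂ T₃ : ExteriorAlgebra ℤ M)
    (hΛ : Λ = Algebra.adjoin ℤ (Set.range fun p : M × M => ι ℤ p.1 * ι ℤ p.2))
    (hh₀ : h₀ = ι ℤ (x 0) * ι ℤ (x 1)) (hh₁ : h₁ = ι ℤ (x 2) * ι ℤ (x 3)) (hl₁ : l₁ = ι ℤ (x 0) * ι ℤ (x 2))
    (hl₂ : l₂ = ι ℤ (x 0) * ι ℤ (x 3)) (hl₃ : l₃ = ι ℤ (x 1) * ι ℤ (x 2)) (hl₄ : l₄ = ι ℤ (x 1) * ι ℤ (x 3))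
    (hh₂ : h₂ = ι ℤ (x 4) * ι ℤ (x 5)) (hh₃ : h₃ = ι ℤ (x 6) * ι ℤ (x 7)) (hh₄ : h₄ = ι ℤ (x 8) * ι ℤ (x 9))
    (hh₅ : h₅ = ι ℤ (x 10) * ι ℤ (x 11)) (ms : s ∈ Λ) (mt : t ∈ Λ) (mu : u ∈ Λ)
    (hH : H = h₀ + h₁) (hH₂ : H₂ = h₀ * h₁) (hS₁ : S₁ = h₂ + h₃ + h₄ + h₅)
    (hS₂ : S₂ = h₂ * h₃ + h₂ * h₄ + h₂ * h₅ + h₃ * h₄ + h₃ * h₅ + h₄ * h₅)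
    (hS₃ : S₃ = h₂ * h₃ * h₄ + h₂ * h₃ * h₅ + h₂ * h₄ * h₅ + h₃ * h₄ * h₅)
    (hD : D = 4 * H + 8 * S₁) (hD₂ : D₂ = 16 * H₂ + 32 * (H * S₁) + 64 * S₂)
    (hD₃ : D₃ = 128 * (H₂ * S₁) + 256 * (H * S₂) + 512 * S₃)
    (mB : B ∈ Submodule.span ℤ (Set.range fun p : M × M => ι ℤ p.1 * ι ℤ p.2))
    (qB : B * B = 2 * B₂) (cB : B * B * B = 6 * B₃)
    (hσ₁ : σ₁ = 0) (hσ₂ : σ₂ = 4 * t - σ₀) (hσ₀ : σ₀ = 2 * s + 1) (hσ₃ : σ₃ = 4 * u)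
    (hT₂ : T₂ = σ₂ * D₂ - 4 * σ₁ * (D * B) + 16 * σ₀ * B₂)
    (hT₃ : T₃ = σ₃ * D₃ - 4 * σ₂ * (D₂ * B) + 16 * σ₁ * (D * B₂) - 64 * σ₀ * B₃) :
    ∀ Z₂ ∈ Λ, ∀ Z₃ : ExteriorAlgebra ℤ M, ¬ (T₂ = 64 * Z₂ ∧ T₃ = 1024 * Z₃) := by
  rintro Z₂ mZ₂ Z₃ ⟨hcrit₂, hcrit₃⟩
  -- the leading digit and the first digit, from `k = 2`
  obtain ⟨β₀₁, β₂₃, n₁, n₂, n₃, n₄, p, X, mX, hB, hp⟩ := edge_leadingDigit_of_criterionL_two x h₀ h₁ l₁ l₂ l₃ l₄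
    h₂ h₃ h₄ h₅ σ₀ σ₁ σ₂ s t H H₂ S₁ S₂ D D₂ B B₂ T₂ Z₂ hh₀ hh₁ hl₁ hl₂ hl₃ hl₄ hh₂ hh₃ hh₄ hh₅ hH hH₂ hS₁ hS₂ hD
    hD₂ mB qB hσ₁ hσ₂ hσ₀ hT₂ hcrit₂
  obtain ⟨c, -, -, hXc⟩ := exists_coeff_of_mem_span x X mX
  have hX : X = c 0 1 • (ι ℤ (x 0) * ι ℤ (x 1)) + c 0 2 • (ι ℤ (x 0) * ι ℤ (x 2)) + c 0 3 • (ι ℤ (x 0) * ι ℤ (x 3)) + c 0 4 •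
      (ι ℤ (x 0) * ι ℤ (x 4)) + c 0 5 • (ι ℤ (x 0) * ι ℤ (x 5)) + c 0 6 • (ι ℤ (x 0) * ι ℤ (x 6)) + c 0 7 • (ι
      ℤ (x 0) * ι ℤ (x 7)) + c 0 8 • (ι ℤ (x 0) * ι ℤ (x 8)) + c 0 9 • (ι ℤ (x 0) * ι ℤ (x 9)) + c 0 10 • (ι ℤ
      (x 0) * ι ℤ (x 10)) + c 0 11 • (ι ℤ (x 0) * ι ℤ (x 11)) + c 1 2 • (ι ℤ (x 1) * ι ℤ (x 2)) + c 1 3 • (ι ℤ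
      (x 1) * ι ℤ (x 3)) + c 1 4 • (ι ℤ (x 1) * ι ℤ (x 4)) + c 1 5 • (ι ℤ (x 1) * ι ℤ (x 5)) + c 1 6 • (ι ℤ (x
      1) * ι ℤ (x 6)) + c 1 7 • (ι ℤ (x 1) * ι ℤ (x 7)) + c 1 8 • (ι ℤ (x 1) * ι ℤ (x 8)) + c 1 9 • (ι ℤ (x 1)
      * ι ℤ (x 9)) + c 1 10 • (ι ℤ (x 1) * ι ℤ (x 10)) + c 1 11 • (ι ℤ (x 1) * ι ℤ (x 11)) + c 2 3 • (ι ℤ (x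
      2) * ι ℤ (x 3)) + c 2 4 • (ι ℤ (x 2) * ι ℤ (x 4)) + c 2 5 • (ι ℤ (x 2) * ι ℤ (x 5)) + c 2 6 • (ι ℤ (x 2)
      * ι ℤ (x 6)) + c 2 7 • (ι ℤ (x 2) * ι ℤ (x 7)) + c 2 8 • (ι ℤ (x 2) * ι ℤ (x 8)) + c 2 9 • (ι ℤ (x 2) *
      ι ℤ (x 9)) + c 2 10 • (ι ℤ (x 2) * ι ℤ (x 10)) + c 2 11 • (ι ℤ (x 2) * ι ℤ (x 11)) + c 3 4 • (ι ℤ (x 3)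
      * ι ℤ (x 4)) + c 3 5 • (ι ℤ (x 3) * ι ℤ (x 5)) + c 3 6 • (ι ℤ (x 3) * ι ℤ (x 6)) + c 3 7 • (ι ℤ (x 3) *
      ι ℤ (x 7)) + c 3 8 • (ι ℤ (x 3) * ι ℤ (x 8)) + c 3 9 • (ι ℤ (x 3) * ι ℤ (x 9)) + c 3 10 • (ι ℤ (x 3) * ι
      ℤ (x 10)) + c 3 11 • (ι ℤ (x 3) * ι ℤ (x 11)) + c 4 5 • (ι ℤ (x 4) * ι ℤ (x 5)) + c 4 6 • (ι ℤ (x 4) * ι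
      ℤ (x 6)) + c 4 7 • (ι ℤ (x 4) * ι ℤ (x 7)) + c 4 8 • (ι ℤ (x 4) * ι ℤ (x 8)) + c 4 9 • (ι ℤ (x 4) * ι ℤ
      (x 9)) + c 4 10 • (ι ℤ (x 4) * ι ℤ (x 10)) + c 4 11 • (ι ℤ (x 4) * ι ℤ (x 11)) + c 5 6 • (ι ℤ (x 5) * ι
      ℤ (x 6)) + c 5 7 • (ι ℤ (x 5) * ι ℤ (x 7)) + c 5 8 • (ι ℤ (x 5) * ι ℤ (x 8)) + c 5 9 • (ι ℤ (x 5) * ι ℤ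
      (x 9)) + c 5 10 • (ι ℤ (x 5) * ι ℤ (x 10)) + c 5 11 • (ι ℤ (x 5) * ι ℤ (x 11)) + c 6 7 • (ι ℤ (x 6) * ι
      ℤ (x 7)) + c 6 8 • (ι ℤ (x 6) * ι ℤ (x 8)) + c 6 9 • (ι ℤ (x 6) * ι ℤ (x 9)) + c 6 10 • (ι ℤ (x 6) * ι ℤ
      (x 10)) + c 6 11 • (ι ℤ (x 6) * ι ℤ (x 11)) + c 7 8 • (ι ℤ (x 7) * ι ℤ (x 8)) + c 7 9 • (ι ℤ (x 7) * ι ℤ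
      (x 9)) + c 7 10 • (ι ℤ (x 7) * ι ℤ (x 10)) + c 7 11 • (ι ℤ (x 7) * ι ℤ (x 11)) + c 8 9 • (ι ℤ (x 8) * ι
      ℤ (x 9)) + c 8 10 • (ι ℤ (x 8) * ι ℤ (x 10)) + c 8 11 • (ι ℤ (x 8) * ι ℤ (x 11)) + c 9 10 • (ι ℤ (x 9) *
      ι ℤ (x 10)) + c 9 11 • (ι ℤ (x 9) * ι ℤ (x 11)) + c 10 11 • (ι ℤ (x 10) * ι ℤ (x 11)) := by
    rw [hXc, sum_pairs_twelve]
    simp only [zsmul_eq_mul]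
  exact edge_unit_classDead x Λ h₀ h₁ l₁ l₂ l₃ l₄ h₂ h₃ h₄ h₅ σ₀ σ₁ σ₂ σ₃ s t u H H₂ S₁ S₂ S₃ D D₂ D₃ _ X B B₂ B₃
    T₂ T₃ β₀₁ β₂₃ n₁ n₂ n₃ n₄ p c hΛ hh₀ hh₁ hl₁ hl₂ hl₃ hl₄ hh₂ hh₃ hh₄ hh₅ ms mt mu hH hH₂ hS₁ hS₂ hS₃ hD hD₂ hD₃
    rfl hp hX hB qB cB hσ₁ hσ₂ hσ₀ hσ₃ hT₂ hT₃ Z₂ mZ₂ Z₃ ⟨hcrit₂, hcrit₃⟩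

end Summit.Ventures.HSemireg.EdgeUnitEveryDigit
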